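import Summits.NavierStokesRegularity.NavierStokesRegularity.Theorems.AxisTwistDoorAveragedConeLiouvilleNUWeakEnergy
import Literature.Analysis.FluidPDE.BiotSavartCurlPair
import HarnessLib

/-!
# N4 / T1 piece W1a (continued): the pointwise integrand identity and the time-weighted energy
# inequality of a LIPSCHITZ generalized supersolution (Nazarov–Ural'tseva 2011, (3.2)/(3.9))

Route `AxisTwistDoor`, crux `AveragedConeLiouville` (stmt-NavierStokesRegularity-26889), INPUT N4 / T1,
programme `kits/N4-T1-skeleton.lean` (118454bf17607d1e), brick W1a of `kits/N4-T1-W1-handoff.md`.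

* `weak_integrand_eq_at` — at a point `p` of the open cylinder where the Lipschitz extension `g` of
  `V` is differentiable, the integrand of the typed weak inequality tested with
  `η = −H'(g)Θ²c` equals `−c·(∂ₜ(H∘V)Θ² + H''(V)|∇V|²Θ² + H'(V)⟪∇V,∇Θ²⟫ + Θ²H'(V)⟪b,∇V⟫)`
  (Rademacher slices `hasFDerivAt_slice_of_differentiableAt` / `hasDerivAt_timeLine_of_differentiableAt`).

WHAT THIS IS NOT: not a statement about Navier–Stokes; T1 is an INPUT; item 26889 and the summit
stay open. [cite: NazarovUraltseva2011HarnackDivFree, §1 p. 2–3, §3 (3.2) (arXiv:1011.1888 p. 8)]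
-/

noncomputable section

-- the summit and its single sub-problem share the name (CONVENTIONS §1)
set_option linter.dupNamespace false

open MeasureTheory Set Function Filter Topology Metric
open scoped NNReal ENNReal InnerProductSpace RealInnerProductSpace

namespace Summit.NavierStokesRegularity.NavierStokesRegularity.Theorems.AveragedConeLiouville.NUPositivity

/-- **The integrand of the weak inequality tested with `η = −H'(g)Θ²c`, at a point of
differentiability of the Lipschitz extension `g` of `V` inside the open cylinder.** [folklore] -/
theorem weak_integrand_eq_at {W : Set (ℝ × EuclideanSpace ℝ (Fin 3))} (hW : IsOpen W)
    {V : ℝ → EuclideanSpace ℝ (Fin 3) → ℝ} {g : ℝ × EuclideanSpace ℝ (Fin 3) → ℝ}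
    (hVg : EqOn (uncurry V) g W) {p : ℝ × EuclideanSpace ℝ (Fin 3)} (hp : p ∈ W)
    (hgd : DifferentiableAt ℝ g p) {H : ℝ → ℝ} (hH : ContDiff ℝ 2 H)
    {Θ : EuclideanSpace ℝ (Fin 3) → ℝ} (hΘ : ContDiff ℝ 1 Θ) (c : ℝ → ℝ)
    (bv : EuclideanSpace ℝ (Fin 3)) :
    deriv (fun s => V s p.2) p.1 * (-deriv H (g (p.1, p.2)) * (Θ p.2 ^ 2 * c p.1)) +
      ⟪gradient (V p.1) p.2,
        gradient (fun x => -deriv H (g (p.1, x)) * (Θ x ^ 2 * c p.1)) p.2⟫ +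
      ⟪bv, gradient (V p.1) p.2⟫ * (-deriv H (g (p.1, p.2)) * (Θ p.2 ^ 2 * c p.1)) =
    -(c p.1 * (deriv (fun s => H (V s p.2)) p.1 * Θ p.2 ^ 2 +
        deriv (deriv H) (V p.1 p.2) * ‖gradient (V p.1) p.2‖ ^ 2 * Θ p.2 ^ 2 +
        deriv H (V p.1 p.2) * ⟪gradient (V p.1) p.2, gradient (fun y => Θ y ^ 2) p.2⟫ +
        Θ p.2 ^ 2 * (deriv H (V p.1 p.2) * ⟪bv, gradient (V p.1) p.2⟫))) := by
  have hp' : (p.1, p.2) = p := Prod.mk.eta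
  -- `V` agrees with `g` near `p` on slices and time lines
  have hVgp : V p.1 p.2 = g p := by have := hVg hp; simpa [uncurry] using this
  have hnx : ∀ᶠ x in 𝓝 p.2, V p.1 x = g (p.1, x) := by
    have h1 : ∀ᶠ x in 𝓝 p.2, (p.1, x) ∈ W :=
      (Continuous.prodMk_right p.1).continuousAt.preimage_mem_nhds (hW.mem_nhds (by simpa using hp))
    filter_upwards [h1] with x hx using hVg hx
  have hnt : ∀ᶠ s in 𝓝 p.1, V s p.2 = g (s, p.2) := by
    have h1 : ∀ᶠ s in 𝓝 p.1, (s, p.2) ∈ W :=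
      (Continuous.prodMk_left p.2).continuousAt.preimage_mem_nhds (hW.mem_nhds (by simpa using hp))
    filter_upwards [h1] with s hs using hVg hs
  -- slice and time derivatives of `g` at `p`
  have hsl := hasFDerivAt_slice_of_differentiableAt hgd
  have htl := hasDerivAt_timeLine_of_differentiableAt hgd
  set Dg : EuclideanSpace ℝ (Fin 3) →L[ℝ] ℝ := (fderiv ℝ g p).comp
    (ContinuousLinearMap.inr ℝ ℝ (EuclideanSpace ℝ (Fin 3))) with hDg
  set dg : ℝ := fderiv ℝ g p ((1 : ℝ), (0 : EuclideanSpace ℝ (Fin 3))) with hdg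
  -- the slice of `V` and its gradient
  have hVsl : HasFDerivAt (V p.1) Dg p.2 := by
    refine hsl.congr_of_eventuallyEq ?_
    filter_upwards [hnx] with x hx using hx
  have hgradV : gradient (V p.1) p.2 = (InnerProductSpace.toDual ℝ (EuclideanSpace ℝ (Fin 3))).symm Dg := by
    rw [gradient, hVsl.fderiv]
  -- the time line of `V`
  have hVtl : HasDerivAt (fun s => V s p.2) dg p.1 := by
    refine htl.congr_of_eventuallyEq ?_
    filter_upwards [hnt] with s hs using hs
  -- `H`, `H'`
  have hH1 : ContDiff ℝ 1 (deriv H) := by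
    have h2 : ContDiff ℝ (1 + 1) H := by rw [one_add_one_eq_two]; exact hH
    exact h2.deriv'
  have hHd : HasDerivAt H (deriv H (g p)) (g p) :=
    ((hH.differentiable (by norm_num)) _).hasDerivAt
  have hH'd : HasDerivAt (deriv H) (deriv (deriv H) (g p)) (g p) :=
    ((hH1.differentiable (by norm_num)) _).hasDerivAt
  -- `∂ₜ (H ∘ V)`
  have hHV : deriv (fun s => H (V s p.2)) p.1 = deriv H (V p.1 p.2) * dg := by
    have hHd' : HasDerivAt H (deriv H (V p.1 p.2)) (V p.1 p.2) := by rw [hVgp]; exact hHd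
    have h := (hHd'.comp p.1 hVtl).deriv
    have e : (H ∘ fun s => V s p.2) = fun s => H (V s p.2) := rfl
    rw [e] at h
    rw [h]
  -- the test slice `x ↦ -H'(g(p.1,x)) Θ(x)² c(p.1)` and its derivative at `p.2`
  have hΘ2 : ContDiff ℝ 1 fun y => Θ y ^ 2 := hΘ.pow 2
  have hΘ2d : HasFDerivAt (fun y => Θ y ^ 2) (fderiv ℝ (fun y => Θ y ^ 2) p.2) p.2 :=
    ((hΘ2.differentiable (by norm_num)) _).hasFDerivAt
  set DΘ : EuclideanSpace ℝ (Fin 3) →L[ℝ] ℝ := fderiv ℝ (fun y => Θ y ^ 2) p.2 with hDΘ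
  have hu : HasFDerivAt (fun x => deriv H (g (p.1, x))) (deriv (deriv H) (g p) • Dg) p.2 := by
    have h1 : HasDerivAt (deriv H) (deriv (deriv H) (g (p.1, p.2))) (g (p.1, p.2)) := by
      rw [hp']; exact hH'd
    have h2 := h1.comp_hasFDerivAt p.2 hsl
    rw [hp'] at h2
    exact h2
  have hw : HasFDerivAt (fun x => Θ x ^ 2 * c p.1) (c p.1 • DΘ) p.2 := hΘ2d.mul_const (c p.1)
  have hη : HasFDerivAt (fun x => -deriv H (g (p.1, x)) * (Θ x ^ 2 * c p.1))
      ((-deriv H (g (p.1, p.2))) • (c p.1 • DΘ) +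
        (Θ p.2 ^ 2 * c p.1) • (-(deriv (deriv H) (g p) • Dg))) p.2 := hu.neg.mul hw
  have hgradη : gradient (fun x => -deriv H (g (p.1, x)) * (Θ x ^ 2 * c p.1)) p.2 =
      (InnerProductSpace.toDual ℝ (EuclideanSpace ℝ (Fin 3))).symm
        ((-deriv H (g (p.1, p.2))) • (c p.1 • DΘ) +
          (Θ p.2 ^ 2 * c p.1) • (-(deriv (deriv H) (g p) • Dg))) := by
    rw [gradient, hη.fderiv]
  -- the inner products
  have hDgV : Dg (gradient (V p.1) p.2) = ‖gradient (V p.1) p.2‖ ^ 2 := by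
    rw [← real_inner_self_eq_norm_sq, Literature.Analysis.FluidPDE.inner_gradient_left, hVsl.fderiv]
  have hDΘV : DΘ (gradient (V p.1) p.2) =
      ⟪gradient (V p.1) p.2, gradient (fun y => Θ y ^ 2) p.2⟫ := by
    rw [real_inner_comm, Literature.Analysis.FluidPDE.inner_gradient_left]
  have hinner : ⟪gradient (V p.1) p.2,
      gradient (fun x => -deriv H (g (p.1, x)) * (Θ x ^ 2 * c p.1)) p.2⟫ =
      (-deriv H (g (p.1, p.2))) * (c p.1 * ⟪gradient (V p.1) p.2, gradient (fun y => Θ y ^ 2) p.2⟫) +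
        (Θ p.2 ^ 2 * c p.1) * (-(deriv (deriv H) (g p) * ‖gradient (V p.1) p.2‖ ^ 2)) := by
    rw [real_inner_comm, hgradη, InnerProductSpace.toDual_symm_apply]
    simp only [_root_.add_apply, FunLike.coe_smul, _root_.neg_apply, Pi.smul_apply, smul_eq_mul,
      hDgV, hDΘV]
  rw [hinner, hHV, hVtl.deriv, hp', hVgp]
  ring

end Summit.NavierStokesRegularity.NavierStokesRegularity.Theorems.AveragedConeLiouville.NUPositivity

end
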